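import Literature.NumberTheory.Automorphic.UnitaryGroupHeisenbergHaar
import HarnessLib

/-!
# The regular twist `u ↦ (t⁻¹ u⁻¹ t) u` of the Heisenberg radical `N(𝔸_F)` of `U(J₃)` by a torus element,
# in the Heisenberg chart (I: algebra)
(Rogawski, *Automorphic Representations of Unitary Groups in Three Variables* (1990), §1.10 (the chart
`u(x, z)`), §7.3 p. 97 (`u(x)⁻¹ γ n(w) u(x) = γ u(A₁ x) n(w + ½ x x̄ (α₂(γ)⁻¹ − α₁(γ)⁻¹))`); Arthur,
*A trace formula for reductive groups I*, Duke Math. J. 45 (1978), §8 (the change of variables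
`n ↦ γ⁻¹ n⁻¹ γ n` on `N` for `γ` regular in the Levi))

Topic `NumberTheory/Automorphic`; namespace `Literature.NumberTheory.Automorphic.UnitaryGroup`.
Proof file: THEOREMS ONLY over ★ `UnitaryGroupHeisenberg` ∕ ★ `UnitaryGroupHeisenbergHaar` (no
definition, no named fact, no instance, no notation, no `sorry`). Setting: `U(J₃)` over the quadratic
`E/F` with involution `c` (`hc : c * c = 1`); `B(𝔸_F) = T(𝔸_F) ⋉ N(𝔸_F)` (★ `isTopSemidirect_borelAdelic`,
`torusInBorel`, `unipotentInBorel`); the Heisenberg chart ★ `heisHomeomorph hc : 𝔸_E × 𝔸_E⁻ ≃ₜ N(𝔸_F)`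
(`heisX`, `heisY`), its group law ★ `heisX_mul` ∕ ★ `coe_heisY_mul` and the diagonal torus action
★ `heisX_conjBy` ∕ ★ `coe_heisY_conjBy` (`t⁻¹ u t ↦ (λ x, μ y)`, `λ = d₀⁻¹ d₁`, `μ = d₀⁻¹ d₂`).

THE POINT (first brick W0 of the weighted ∕ unipotent terms of the T1-qs road, RULING #114b of the
cell). For `t = diag(d) ∈ T(𝔸_F)` and `u ∈ N(𝔸_F)`, the conjugate `u⁻¹ t u` equals `t · τ_t(u)` with the
TWIST `τ_t(u) := (t⁻¹ u⁻¹ t) · u ∈ N(𝔸_F)`, and in the chart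
**`x(τ_t u) = (1 − λ) · x(u)`** (the `x`-PART: a bijection of `N ∕ Z_N ≅ 𝔸_E` as soon as `1 − λ` is a
unit — the single hypothesis `α₁(t) ≠ 1` of the singular twist, Rogawski p. 97) and
**`y(τ_t u) = (1 − μ) · y(u) + ½ (λ − c λ) · x(u) c(x(u))`** (a skew product over the `x`-part). For a
REGULAR hyperbolic `t` (`λ ≠ 1`, `μ ≠ 1` units) `τ_t` is therefore a homeomorphism of `N(𝔸_F)` scaling
the Haar measure by `‖1 − λ‖_{𝔸_E} · χ⁻(1 − μ)` — the change of variables behind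
`∫_N φ(t n) dn = |Δ(t)|⁻¹ ∫_N φ(n⁻¹ t n) dn` (sequel file, W0 (II)).

* §1 `heisX_one`, `coe_heisY_one`, `heisX_inv`, `coe_heisY_inv` — identity and inverse in the chart.
* §2 `inv_mul_mul_eq_mul_twist` (`u⁻¹ t u = t · τ_t(u)`), **`heisX_twist`**, **`coe_heisY_twist`**.

## References

* J. D. Rogawski, *Automorphic Representations of Unitary Groups in Three Variables*, Ann. of Math.
  Studies 123 (1990), §1.10, §7.3 (p. 97) [Rogawski1990].
* J. Arthur, *A trace formula for reductive groups I*, Duke Math. J. 45 (1978), §8 — cited through the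
  held exposition above.
-/

set_option autoImplicit false

noncomputable section

open Matrix NumberField IsDedekindDomain Topology

namespace Literature.NumberTheory.Automorphic

namespace UnitaryGroup

variable {F E : Type} [Field F] [NumberField F] [Field E] [NumberField E] [Algebra F E]
  {c : E ≃ₐ[F] E}

/-! ## §1 Identity and inverse in the Heisenberg chart -/

/-- `x(1) = 0`. [cite: Rogawski1990, §1.10] -/
theorem heisX_one : heisX (1 : unipotentInBorel F E c 3) = 0 := by
  have h := heisX_mul (1 : unipotentInBorel F E c 3) 1
  rw [mul_one] at h
  exact left_eq_add.mp h

/-- `y(1) = 0`. [cite: Rogawski1990, §1.10] -/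
theorem coe_heisY_one (hc : c * c = 1) :
    (heisY hc (1 : unipotentInBorel F E c 3) : AdeleRing (𝓞 E) E) = 0 := by
  have h := coe_heisY_mul hc (1 : unipotentInBorel F E c 3) 1
  rw [mul_one, sub_self, mul_zero, add_zero] at h
  exact left_eq_add.mp h

/-- **`x(u⁻¹) = −x(u)`** (`x` is additive). [cite: Rogawski1990, §1.10] -/
theorem heisX_inv (u : unipotentInBorel F E c 3) : heisX u⁻¹ = -heisX u := by
  have h := heisX_mul u u⁻¹
  rw [mul_inv_cancel, heisX_one] at h
  exact eq_neg_of_add_eq_zero_right h.symm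

/-- **`y(u⁻¹) = −y(u)`** (the cocycle `½(x(u⁻¹) c(x(u)) − x(u) c(x(u⁻¹)))` vanishes). [cite: Rogawski1990, §1.10] -/
theorem coe_heisY_inv (hc : c * c = 1) (u : unipotentInBorel F E c 3) :
    (heisY hc u⁻¹ : AdeleRing (𝓞 E) E) = -(heisY hc u : AdeleRing (𝓞 E) E) := by
  have h := coe_heisY_mul hc u u⁻¹
  rw [mul_inv_cancel, coe_heisY_one hc, heisX_inv, map_neg] at h
  have h' : (heisY hc u : AdeleRing (𝓞 E) E) + (heisY hc u⁻¹ : AdeleRing (𝓞 E) E) = 0 := by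
    linear_combination -h
  exact eq_neg_of_add_eq_zero_right h'

/-! ## §2 The twist `τ_t(u) = (t⁻¹ u⁻¹ t) u` in the chart -/

/-- **`u⁻¹ t u = t · τ_t(u)`** with `τ_t(u) = (t⁻¹ u⁻¹ t) u ∈ N(𝔸_F)` (in `B(𝔸_F)`). [cite: Rogawski1990, §7.3 (p. 97)] -/
theorem inv_mul_mul_eq_mul_twist (t : torusInBorel F E c 3) (u : unipotentInBorel F E c 3) :
    ((u : borelAdelic F E c 3))⁻¹ * (t : borelAdelic F E c 3) * (u : borelAdelic F E c 3) =
      (t : borelAdelic F E c 3) *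
        ((isTopSemidirect_borelAdelic.conjBy t u⁻¹ * u : unipotentInBorel F E c 3) : borelAdelic F E c 3) := by
  show ((u : borelAdelic F E c 3))⁻¹ * (t : borelAdelic F E c 3) * (u : borelAdelic F E c 3) =
    (t : borelAdelic F E c 3) * (((t : borelAdelic F E c 3)⁻¹ *
      ((u⁻¹ : unipotentInBorel F E c 3) : borelAdelic F E c 3) * (t : borelAdelic F E c 3)) *
        (u : borelAdelic F E c 3))
  rw [Subgroup.coe_inv]
  group

/-- **The `x`-part of the twist: `x(τ_t u) = (1 − λ) · x(u)`**, `λ = d₀⁻¹ d₁` for `t = diag(d)` — on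
`N ∕ Z_N ≅ 𝔸_E` the twist is multiplication by `1 − α₁(t)⁻¹`-type scalar, a bijection under the SINGLE
hypothesis that `1 − λ` is a unit (Rogawski (1990), p. 97: `u(x) ↦ u(A₁ x)`). [cite: Rogawski1990, §7.3 (p. 97)] -/
theorem heisX_twist (t : torusInBorel F E c 3) {d : Fin 3 → (AdeleRing (𝓞 E) E)ˣ}
    (hd : glDiagonal 3 (AdeleRing (𝓞 E) E) d =
      adelicVal F E c 3 _ ((t : borelAdelic F E c 3) : (quasiSplit F E c 3).Adelic))
    (u : unipotentInBorel F E c 3) :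
    heisX (isTopSemidirect_borelAdelic.conjBy t u⁻¹ * u) =
      (1 - (((d 0)⁻¹ * d 1 : (AdeleRing (𝓞 E) E)ˣ) : AdeleRing (𝓞 E) E)) * heisX u := by
  rw [heisX_mul, heisX_conjBy t hd, heisX_inv]
  ring

/-- **The `y`-part of the twist: `y(τ_t u) = (1 − μ) · y(u) + ½ (λ − c λ) · x(u) c(x(u))`**,
`λ = d₀⁻¹ d₁`, `μ = d₀⁻¹ d₂` — a SKEW product over the `x`-part (Rogawski (1990), p. 97:
`n(w) ↦ n(w + ½ x x̄ (α₂⁻¹ − α₁⁻¹))` up to the torus scaling). [cite: Rogawski1990, §7.3 (p. 97)] -/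
theorem coe_heisY_twist (hc : c * c = 1) (t : torusInBorel F E c 3) {d : Fin 3 → (AdeleRing (𝓞 E) E)ˣ}
    (hd : glDiagonal 3 (AdeleRing (𝓞 E) E) d =
      adelicVal F E c 3 _ ((t : borelAdelic F E c 3) : (quasiSplit F E c 3).Adelic))
    (u : unipotentInBorel F E c 3) :
    (heisY hc (isTopSemidirect_borelAdelic.conjBy t u⁻¹ * u) : AdeleRing (𝓞 E) E) =
      (1 - (((d 0)⁻¹ * d 2 : (AdeleRing (𝓞 E) E)ˣ) : AdeleRing (𝓞 E) E)) * (heisY hc u : AdeleRing (𝓞 E) E) +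
        halfAdele * ((((d 0)⁻¹ * d 1 : (AdeleRing (𝓞 E) E)ˣ) : AdeleRing (𝓞 E) E) -
          conjAdele F E c (((d 0)⁻¹ * d 1 : (AdeleRing (𝓞 E) E)ˣ) : AdeleRing (𝓞 E) E)) *
          (heisX u * conjAdele F E c (heisX u)) := by
  rw [coe_heisY_mul hc, coe_heisY_conjBy hc t hd, heisX_conjBy t hd, coe_heisY_inv hc, heisX_inv]
  simp only [map_neg, map_mul, mul_neg, neg_mul]
  ring

end UnitaryGroup

end Literature.NumberTheory.Automorphic

end
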